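import Summits.RiemannHypothesis.RiemannHypothesis.Theorems.PfPersistenceMarkovCoreWindowShift
import HarnessLib

/-!
# PF persistence (theory 1, edge law): THE MARKOV CORE, XV — the arch-only bottom as a function
# of the WINDOW: monotonicity, the window dial lemma, continuity, stability of the ground state

Helper file (`--supports stmt-RiemannHypothesis-19953`); mechanism/rigidity campaign; no RH claims.
Companion text `run/shared/lean/pub/pub-rhpf/pub-rhpf-theory-1/THEORY-EDGE-8.md`.

With the window-shift calculus of file XIV (`PfPersistenceMarkovCoreWindowShift`: the dilation
`weilDilate (b/a − 1)` moves the finite-energy class of the window `b` onto that of the window `a` at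
energy cost `≤ 32 C |a/b − 1| ‖f‖₂²`), the arch-only window bottom
`archBottom a = coreBottom 0 a = inf {𝓔_arch(f) : f ∈ coreAdm a, ‖f‖₂ = 1}` is, on `(0, ∞)`:

* ANTITONE (`archBottom_antitoneOn`: class inclusion — a larger window can only lower the bottom;
  Bombieri's Thm 5 for the core);
* locally LIPSCHITZ: `archBottom a ≤ archBottom b + 32 C |a/b − 1|` for `b ≤ 2a`
  (`archBottom_le_add`, the WINDOW DIAL LEMMA), hence continuous (`continuousAt_archBottom`);
* and its ground state is STABLE under the move: if `b_k → a` and `u_k` are arch-only core ground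
  states of the windows `b_k`, `u` one of the window `a`, then the moved states
  `weilDilate (b_k/a − 1) u_k → u` in `L²` modulo unimodular constants
  (`IsCoreGround.tendsto_of_windows`; via `tendsto_archEnergy_windowShift`: moved near-minimisers of
  nearby windows are a minimising sequence, and file VIII `IsCoreGround.tendsto_of_minimizing`).

All of it for the arch-only core of EVERY windowed form of this type (structure, not an invariant of
ζ); the prime atoms are absent here by design (file XVI explains what they add).  §4 collects small
tools for file XVI (round trip of the window shift, slope bookkeeping, phase removal, clamping).

References: E. Bombieri, Rend. Mat. Acc. Lincei (9) 11 (2000) 183–233, §4 Thm 3, Thm 5;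
T. Kato, *Perturbation Theory for Linear Operators* (1966), VII §4, VIII §§3–4.
-/

set_option linter.dupNamespace false

noncomputable section

open MeasureTheory Set Filter Metric
open scoped Topology

namespace Summit.RiemannHypothesis.RiemannHypothesis.Theorems.PfPersistence

open Literature.NumberTheory.LFunctions
open Summit.RiemannHypothesis.RiemannHypothesis.Theorems.WeilWindowFlowWindowLipschitz
  (stub_barrierEnergy_weilIncrement_le_four)
open Summit.RiemannHypothesis.RiemannHypothesis.Theorems.WeilGroundStateMarkovPart

variable {a b : ℝ}

/-! ## §1 The variational principle and monotonicity in the window -/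

/-- The variational principle for the arch-only bottom: `archBottom a ≤ 𝓔_arch(f)` for every
normalised `f ∈ coreAdm a`. [cite: ReedSimonIV1978, §XIII.1 (min–max / Rayleigh quotient)] -/
theorem archBottom_le {f : ℝ → ℂ} (hf : coreAdm a f) (hn : ∫ x, ‖f x‖ ^ 2 = (1 : ℝ)) :
    archBottom a ≤ archEnergy f := by
  rw [archBottom, ← tableDirichletEnergy_archOnly a f]
  exact coreBottom_le (archOnly_nonneg a) hf hn

/-- `0 ≤ archBottom a` (`a > 0`). [folklore] -/
theorem archBottom_nonneg (ha : 0 < a) : 0 ≤ archBottom a :=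
  coreBottom_nonneg (archOnly_nonneg a) ha

/-- A core ground state of the arch-only table attains the arch bottom. [folklore] -/
theorem IsCoreGround.archEnergy_eq {u : ℝ → ℂ} (hu : IsCoreGround (fun _ ↦ (0 : ℝ)) a u) :
    archEnergy u = archBottom a := by
  rw [← tableDirichletEnergy_archOnly a u, archBottom]
  exact hu.2.2

/-- **A larger window can only lower the arch bottom**: `archBottom` is antitone on `(0, ∞)`
(the finite-energy class of `[-a, a]` is contained in that of `[-b, b]` for `a ≤ b`, with the same
energy). [cite: Bombieri2000Weil, Thm 5] -/
theorem archBottom_antitoneOn : AntitoneOn archBottom (Ioi 0) := by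
  intro a ha b _ hab
  refine le_csInf (coreSet_nonempty _ ha) ?_
  rintro _ ⟨f, hf, hn, rfl⟩
  have hfb : coreAdm b f :=
    ⟨hf.1, fun x hx ↦ hf.2.1 x (fun h ↦ hx (Icc_subset_Icc (by linarith) hab h)), hf.2.2⟩
  rw [tableDirichletEnergy_archOnly, ← tableDirichletEnergy_archOnly b]
  exact coreBottom_le (archOnly_nonneg b) hfb hn

/-! ## §2 The window dial lemma and continuity -/

/-- **WINDOW DIAL LEMMA**: for `0 < a`, `0 < b ≤ 2a`,
`archBottom a ≤ archBottom b + 32 C |a/b − 1|` — move every normalised state of the window `b`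
to the window `a` (`coreAdm_windowShift`, `archEnergy_windowShift_le`) and take the infimum.
[cite: Kato1966, VII §4 (forms depending on a parameter), VIII §3] -/
theorem archBottom_le_add (ha : 0 < a) (hb : 0 < b) (hab : b ≤ 2 * a) :
    archBottom a ≤ archBottom b + 32 * archVirialConst * |a / b - 1| := by
  have hK : ∀ f : ℝ → ℂ, coreAdm b f → ∫ x, ‖f x‖ ^ 2 = (1 : ℝ) →
      archBottom a ≤ archEnergy f + 32 * archVirialConst * |a / b - 1| := by
    intro f hf hn
    have h1 := archBottom_le (coreAdm_windowShift hf ha hb)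
      (by rw [integral_norm_sq_weilDilate f (windowShift_param ha hb).1, hn])
    have h2 := archEnergy_windowShift_le hf.1 hf.2.2 ha hb hab
    rw [hn, mul_one] at h2
    exact h1.trans h2
  have h : archBottom a - 32 * archVirialConst * |a / b - 1| ≤ archBottom b := by
    refine le_csInf (coreSet_nonempty _ hb) ?_
    rintro _ ⟨f, hf, hn, rfl⟩
    rw [tableDirichletEnergy_archOnly]
    linarith [hK f hf hn]
  linarith

/-- **The arch bottom is continuous on `(0, ∞)`**: `|archBottom b − archBottom a| ≤ 64 C |b − a|/a`
for `b ∈ (a/2, 2a)` (the dial lemma both ways). [cite: Kato1966, VII §4, VIII §3] -/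
theorem continuousAt_archBottom (ha : 0 < a) : ContinuousAt archBottom a := by
  rw [ContinuousAt, tendsto_iff_norm_sub_tendsto_zero]
  have hev : ∀ᶠ b in 𝓝 a, ‖archBottom b - archBottom a‖ ≤ 64 * archVirialConst / a * |b - a| := by
    filter_upwards [Ioo_mem_nhds (show a / 2 < a by linarith) (show a < 2 * a by linarith)]
      with b hb
    have hb0 : 0 < b := by linarith [hb.1]
    have h1 := archBottom_le_add ha hb0 hb.2.le
    have h2 := archBottom_le_add hb0 ha (by linarith [hb.1])
    have e1 : |a / b - 1| = |b - a| / b := by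
      rw [show a / b - 1 = -(b - a) / b by field_simp; ring, abs_div, abs_neg, abs_of_pos hb0]
    have e2 : |b / a - 1| = |b - a| / a := by
      rw [show b / a - 1 = (b - a) / a by field_simp, abs_div, abs_of_pos ha]
    have hC := archVirialConst_pos
    have i1 : |b - a| / b ≤ 2 * |b - a| / a := by
      rw [div_le_div_iff₀ hb0 ha]
      nlinarith [abs_nonneg (b - a), hb.1]
    have i2 : |b - a| / a ≤ 2 * |b - a| / a :=
      div_le_div_of_nonneg_right (by linarith [abs_nonneg (b - a)]) ha.le
    rw [e1] at h1
    rw [e2] at h2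
    rw [Real.norm_eq_abs, abs_sub_le_iff]
    have e3 : 64 * archVirialConst / a * |b - a| = 32 * archVirialConst * (2 * |b - a| / a) := by
      ring
    rw [e3]
    constructor <;> nlinarith
  have h0 : Tendsto (fun b : ℝ ↦ 64 * archVirialConst / a * |b - a|) (𝓝 a) (𝓝 0) := by
    have h : Tendsto (fun b : ℝ ↦ 64 * archVirialConst / a * |id b - a|) (𝓝 a)
        (𝓝 (64 * archVirialConst / a * |id a - a|)) :=
      ((tendsto_id.sub_const a).abs).const_mul (64 * archVirialConst / a)
    simpa using h
  exact squeeze_zero' (Eventually.of_forall fun _ ↦ norm_nonneg _) hev h0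

/-- `archBottom` is continuous on `(0, ∞)`. [cite: Kato1966, VII §4, VIII §3] -/
theorem continuousOn_archBottom : ContinuousOn archBottom (Ioi 0) :=
  continuousOn_of_forall_continuousAt fun _ ha ↦ continuousAt_archBottom ha

/-! ## §3 Stability: moved near-minimisers are minimising; moved ground states converge -/

/-- **Moved near-minimisers of nearby windows are a minimising sequence.** Let `b_k → a`
(`a, b_k > 0`) and let `g_k ∈ coreAdm (b_k)` be normalised with
`𝓔_arch(g_k) ≤ archBottom (b_k) + δ_k`, `δ_k → 0`.  Then the window-`a` states
`h_k = weilDilate (b_k/a − 1) g_k` have `𝓔_arch(h_k) → archBottom a`. [cite: Bombieri2000Weil, §4 Thm 3] -/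
theorem tendsto_archEnergy_windowShift (ha : 0 < a) {bk : ℕ → ℝ} (hb : ∀ k, 0 < bk k)
    (hba : Tendsto bk atTop (𝓝 a)) {g : ℕ → ℝ → ℂ} (hg : ∀ k, coreAdm (bk k) (g k))
    (hgn : ∀ k, ∫ x, ‖g k x‖ ^ 2 = (1 : ℝ)) {δ : ℕ → ℝ} (hδ : Tendsto δ atTop (𝓝 0))
    (hgE : ∀ k, archEnergy (g k) ≤ archBottom (bk k) + δ k) :
    Tendsto (fun k ↦ archEnergy (weilDilate (bk k / a - 1) (g k))) atTop (𝓝 (archBottom a)) := by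
  have hlow : ∀ k, archBottom a ≤ archEnergy (weilDilate (bk k / a - 1) (g k)) := fun k ↦
    archBottom_le (coreAdm_windowShift (hg k) ha (hb k))
      (by rw [integral_norm_sq_weilDilate _ (windowShift_param ha (hb k)).1, hgn k])
  have hev : ∀ᶠ k in atTop, bk k ≤ 2 * a :=
    hba.eventually (Iic_mem_nhds (show a < 2 * a by linarith))
  have hup : ∀ᶠ k in atTop, archEnergy (weilDilate (bk k / a - 1) (g k)) ≤
      archBottom (bk k) + δ k + 32 * archVirialConst * |a / bk k - 1| := by
    filter_upwards [hev] with k hk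
    have h := archEnergy_windowShift_le (hg k).1 (hg k).2.2 ha (hb k) hk
    rw [hgn k, mul_one] at h
    linarith [hgE k]
  have hlim : Tendsto (fun k ↦ archBottom (bk k) + δ k + 32 * archVirialConst * |a / bk k - 1|)
      atTop (𝓝 (archBottom a)) := by
    have h1 : Tendsto (fun k ↦ archBottom (bk k)) atTop (𝓝 (archBottom a)) :=
      (continuousAt_archBottom ha).tendsto.comp hba
    have h2 : Tendsto (fun k ↦ |a / bk k - 1|) atTop (𝓝 0) := by
      have h := ((tendsto_const_nhds (x := a)).div hba ha.ne').sub_const 1 |>.abs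
      simpa [div_self ha.ne'] using h
    simpa using (h1.add hδ).add (h2.const_mul (32 * archVirialConst))
  exact tendsto_of_tendsto_of_tendsto_of_le_of_le' tendsto_const_nhds hlim
    (Eventually.of_forall hlow) hup

/-- **Test approximants along moving windows.** For arch-only core ground states `u_k` of windows
`b_k → a` there are window-`b_k` tests `g_k` (`‖g_k‖₂ = 1`, `∫|g_k − u_k|² ≤ 1/(k+1)`) whose moved
copies `h_k = weilDilate (b_k/a − 1) g_k` are window-`a` tests with `𝓔_arch(h_k) → archBottom a`.
[cite: Bombieri2000Weil, §4 Thm 3] -/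
theorem exists_isWeilTest_windowShift_minimizing (ha : 0 < a) {bk : ℕ → ℝ} (hb : ∀ k, 0 < bk k)
    (hba : Tendsto bk atTop (𝓝 a)) {uk : ℕ → ℝ → ℂ}
    (huk : ∀ k, IsCoreGround (fun _ ↦ (0 : ℝ)) (bk k) (uk k)) :
    ∃ g : ℕ → ℝ → ℂ, (∀ k, IsWeilTest (weilDilate (bk k / a - 1) (g k)) ∧
        tsupport (weilDilate (bk k / a - 1) (g k)) ⊆ Icc (-a) a ∧
        ∫ t, ‖weilDilate (bk k / a - 1) (g k) t‖ ^ 2 = (1 : ℝ)) ∧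
      (∀ k, MemLp (g k) 2) ∧ (∀ k, ∫ x, ‖g k x - uk k x‖ ^ 2 ≤ 1 / ((k : ℝ) + 1)) ∧
      Tendsto (fun k ↦ archEnergy (weilDilate (bk k / a - 1) (g k))) atTop (𝓝 (archBottom a)) := by
  have hstep : ∀ k : ℕ, ∃ g : ℝ → ℂ, IsWeilTest g ∧ tsupport g ⊆ Icc (-(bk k)) (bk k) ∧
      ∫ t, ‖g t‖ ^ 2 = (1 : ℝ) ∧
        tableDirichletEnergy (bk k) (fun _ ↦ (0 : ℝ)) g ≤
            coreBottom (fun _ ↦ (0 : ℝ)) (bk k) + 1 / ((k : ℝ) + 1) ∧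
          ∫ x, ‖g x - uk k x‖ ^ 2 ≤ 1 / ((k : ℝ) + 1) := fun k ↦
    (huk k).exists_isWeilTest_near (archOnly_nonneg _) (hb k) (by positivity)
  choose g hg hgs hgn hgE hgd using hstep
  refine ⟨g, fun k ↦ ⟨(isWeilTest_windowShift (hg k) (hgs k) ha (hb k)).1,
    (isWeilTest_windowShift (hg k) (hgs k) ha (hb k)).2,
    by rw [integral_norm_sq_weilDilate _ (windowShift_param ha (hb k)).1, hgn k]⟩,
    fun k ↦ (hg k).memLp_two, hgd, ?_⟩
  refine tendsto_archEnergy_windowShift ha hb hba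
    (fun k ↦ coreAdm_of_isWeilTest (hg k) (hgs k)) hgn tendsto_one_div_add_atTop_nhds_zero_nat
    (fun k ↦ ?_)
  have h := hgE k
  rwa [tableDirichletEnergy_archOnly] at h

/-- **STABILITY OF THE ARCH-ONLY CORE GROUND STATE UNDER A CHANGE OF WINDOW.**  Let `b_k → a`
(`a, b_k > 0`), let `u_k` be arch-only core ground states of the windows `[-b_k, b_k]` and `u` one
of `[-a, a]`.  Then the moved states `weilDilate (b_k/a − 1) u_k` converge to `u` in `L²` modulo
unimodular constants. [cite: Bombieri2000Weil, §4 Thm 3] -/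
theorem IsCoreGround.tendsto_of_windows (ha : 0 < a) {bk : ℕ → ℝ} (hb : ∀ k, 0 < bk k)
    (hba : Tendsto bk atTop (𝓝 a)) {u : ℝ → ℂ} (hu : IsCoreGround (fun _ ↦ (0 : ℝ)) a u)
    {uk : ℕ → ℝ → ℂ} (huk : ∀ k, IsCoreGround (fun _ ↦ (0 : ℝ)) (bk k) (uk k)) :
    ∃ c : ℕ → ℂ, (∀ k, ‖c k‖ = 1) ∧
      Tendsto (fun k ↦ ∫ x, ‖c k * weilDilate (bk k / a - 1) (uk k) x - u x‖ ^ 2)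
        atTop (𝓝 0) := by
  obtain ⟨g, hG, hgm, hgd, hE⟩ := exists_isWeilTest_windowShift_minimizing ha hb hba huk
  -- file VIII at the window `a`
  have hE' : Tendsto (fun k ↦ tableDirichletEnergy a (fun _ ↦ (0 : ℝ))
      (weilDilate (bk k / a - 1) (g k))) atTop (𝓝 (coreBottom (fun _ ↦ (0 : ℝ)) a)) := by
    simp only [tableDirichletEnergy_archOnly]
    exact hE
  obtain ⟨c, hcn, hlim⟩ := hu.tendsto_of_minimizing (archOnly_nonneg a) ha hG hE'
  refine ⟨c, hcn, ?_⟩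
  -- transfer back to the moved ground states: the dilation is unitary and linear
  have huL : MemLp u 2 := hu.1.1
  have hb' : ∀ k, ∫ x, ‖c k * weilDilate (bk k / a - 1) (uk k) x - u x‖ ^ 2 ≤
      2 * (1 / ((k : ℝ) + 1)) + 2 * ∫ x, ‖c k * weilDilate (bk k / a - 1) (g k) x - u x‖ ^ 2 := by
    intro k
    have hη := (windowShift_param ha (hb k)).1
    set η : ℝ := bk k / a - 1 with hηdef
    have hA : MemLp (fun x ↦ c k * weilDilate η (fun t ↦ uk k t - g k t) x) 2 :=
      (Summit.RiemannHypothesis.RiemannHypothesis.Theorems.OddSector.memLp_weilDilate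
        ((huk k).1.1.sub (hgm k)) hη).const_mul (c k)
    have hB : MemLp (fun x ↦ c k * weilDilate η (g k) x - u x) 2 :=
      ((Summit.RiemannHypothesis.RiemannHypothesis.Theorems.OddSector.memLp_weilDilate
        (hgm k) hη).const_mul (c k)).sub huL
    have h := integral_norm_sq_add_le hA hB
    have e1 : (fun x ↦ ‖c k * weilDilate η (fun t ↦ uk k t - g k t) x +
        (c k * weilDilate η (g k) x - u x)‖ ^ 2) =
        fun x ↦ ‖c k * weilDilate η (uk k) x - u x‖ ^ 2 := by
      funext x
      rw [weilDilate_sub]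
      ring_nf
    have e2 : ∫ x, ‖c k * weilDilate η (fun t ↦ uk k t - g k t) x‖ ^ 2 =
        ∫ x, ‖g k x - uk k x‖ ^ 2 := by
      have h1 : (fun x ↦ ‖c k * weilDilate η (fun t ↦ uk k t - g k t) x‖ ^ 2) =
          fun x ↦ ‖weilDilate η (fun t ↦ uk k t - g k t) x‖ ^ 2 := by
        funext x
        rw [norm_mul, hcn k, one_mul]
      rw [h1, integral_norm_sq_weilDilate _ hη]
      exact integral_congr_ae (Eventually.of_forall fun x ↦ by simp only [norm_sub_rev])
    rw [e1, e2] at h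
    linarith [hgd k]
  have h0 : Tendsto (fun k : ℕ ↦ 2 * (1 / ((k : ℝ) + 1)) +
      2 * ∫ x, ‖c k * weilDilate (bk k / a - 1) (g k) x - u x‖ ^ 2) atTop (𝓝 0) := by
    simpa using (tendsto_one_div_add_atTop_nhds_zero_nat.const_mul 2).add (hlim.const_mul 2)
  exact squeeze_zero (fun k ↦ integral_nonneg fun _ ↦ by positivity) hb' h0

/-! ## §4 Toolbox for the window Feynman–Hellmann theorem (file XVI) -/

/-- `weilArchVirialDensity = (tρ)′` is continuous away from `0`. [folklore] -/
theorem continuousAt_weilArchVirialDensity {t : ℝ} (ht : t ≠ 0) :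
    ContinuousAt weilArchVirialDensity t := by
  have hnum : Continuous fun t : ℝ ↦
      Real.exp (t / 2) * ((2 + t) * Real.sinh t - 2 * t * Real.cosh t) :=
    (Real.continuous_exp.comp (continuous_id.div_const 2)).mul
      (((continuous_const.add continuous_id).mul Real.continuous_sinh).sub
        ((continuous_const.mul continuous_id).mul Real.continuous_cosh))
  have hden : Continuous fun t : ℝ ↦ 4 * Real.sinh t ^ 2 :=
    continuous_const.mul (Real.continuous_sinh.pow 2)
  have hne : 4 * Real.sinh t ^ 2 ≠ 0 := by
    have : Real.sinh t ≠ 0 := Real.sinh_ne_zero.mpr ht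
    positivity
  exact hnum.continuousAt.div hden.continuousAt hne

/-- Round trip of the window shift: `weilDilate (a/b − 1) (weilDilate (b/a − 1) g) = g`. [folklore] -/
theorem weilDilate_windowShift_roundtrip (ha : 0 < a) (hb : 0 < b) (g : ℝ → ℂ) :
    weilDilate (a / b - 1) (weilDilate (b / a - 1) g) = g := by
  funext t
  simp only [weilDilate_apply]
  have hab : b / a * (a / b) = 1 := by
    rw [div_mul_div_comm, div_eq_one_iff_eq (by positivity)]
    ring
  have hab' : a / b * (b / a) = 1 := by rw [mul_comm]; exact hab
  have h1 : (1 + (b / a - 1)) * ((1 + (a / b - 1)) * t) = t := by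
    rw [show 1 + (b / a - 1) = b / a by ring, show 1 + (a / b - 1) = a / b by ring, ← mul_assoc,
      hab, one_mul]
  have h2 : (Real.sqrt (1 + (a / b - 1)) : ℂ) * (Real.sqrt (1 + (b / a - 1)) : ℂ) = 1 := by
    rw [show 1 + (a / b - 1) = a / b by ring, show 1 + (b / a - 1) = b / a by ring,
      ← Complex.ofReal_mul, ← Real.sqrt_mul (div_pos ha hb).le, hab', Real.sqrt_one,
      Complex.ofReal_one]
  rw [h1, ← mul_assoc, h2, one_mul]

/-- From the sandwich to the slopes: if `(b/a − 1) I ≤ Δ ≤ (b/a − 1) J` (`b ≠ a`, `a > 0`) then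
`Δ/(b − a)` lies between `I/a` and `J/a`. [folklore] -/
theorem slope_mem_of_bounds {Δ I J : ℝ} (ha : 0 < a) (hd : b - a ≠ 0) (h1 : (b / a - 1) * I ≤ Δ)
    (h2 : Δ ≤ (b / a - 1) * J) :
    min (I / a) (J / a) ≤ Δ / (b - a) ∧ Δ / (b - a) ≤ max (I / a) (J / a) := by
  rw [show b / a - 1 = (b - a) / a by field_simp] at h1 h2
  generalize b - a = d at hd h1 h2 ⊢
  rcases lt_trichotomy d 0 with hd | hd | hd
  · have e1 : J / a ≤ Δ / d := by
      rw [le_div_iff_of_neg hd]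
      calc Δ ≤ d / a * J := h2
        _ = J / a * d := by ring
    have e2 : Δ / d ≤ I / a := by
      rw [div_le_iff_of_neg hd]
      calc I / a * d = d / a * I := by ring
        _ ≤ Δ := h1
    exact ⟨(min_le_right _ _).trans e1, e2.trans (le_max_left _ _)⟩
  · exact absurd hd ‹d ≠ 0›
  · have e1 : I / a ≤ Δ / d := by
      rw [le_div_iff₀ hd]
      calc I / a * d = d / a * I := by ring
        _ ≤ Δ := h1
    have e2 : Δ / d ≤ J / a := by
      rw [div_le_iff₀ hd]
      calc Δ ≤ d / a * J := h2
        _ = J / a * d := by ring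
    exact ⟨(min_le_left _ _).trans e1, e2.trans (le_max_right _ _)⟩

/-- Removing unimodular phases from a convergence of increments. [folklore] -/
theorem tendsto_weilIncrement_of_tendsto_phase {u : ℝ → ℂ} (hu : MemLp u 2) {m : ℕ → ℝ → ℂ}
    (hm : ∀ k, MemLp (m k) 2) {c : ℕ → ℂ} (hcn : ∀ k, ‖c k‖ = 1)
    (hlim : Tendsto (fun k ↦ ∫ x, ‖c k * m k x - u x‖ ^ 2) atTop (𝓝 0)) {s : ℝ} :
    Tendsto (fun k ↦ weilIncrement (m k) s) atTop (𝓝 (weilIncrement u s)) := by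
  have h := tendsto_weilIncrement_of_tendsto hu (fun k ↦ (hm k).const_mul (c k)) hlim s
  refine h.congr fun k ↦ ?_
  rw [weilIncrement_const_mul, hcn k, one_pow, one_mul]

/-- A sequence converging to `a > 0` clamped to `(0, ∞)`: positivity, the limit, and eventual
agreement. [folklore] -/
theorem clamp_seq (ha : 0 < a) {x : ℕ → ℝ} (hx : Tendsto x atTop (𝓝 a)) :
    ∃ b : ℕ → ℝ, (∀ k, 0 < b k) ∧ Tendsto b atTop (𝓝 a) ∧ ∀ᶠ k in atTop, b k = x k := by
  refine ⟨fun k ↦ max (x k) (a / 2), fun k ↦ lt_max_of_lt_right (half_pos ha), ?_, ?_⟩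
  · have h := hx.max (tendsto_const_nhds (x := a / 2))
    rwa [max_eq_left (half_le_self ha.le)] at h
  · exact (hx.eventually (Ioi_mem_nhds (half_lt_self ha))).mono fun k hk ↦ max_eq_left hk.le

end Summit.RiemannHypothesis.RiemannHypothesis.Theorems.PfPersistence

end
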